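import Summits.CriticalPhenomena.Ising3DConformalLimit.Theorems.EnergyNotSigmaSquaredMoebiusLimitExistsOrbitLiouvilleDefs
import Literature.Analysis.Complex.LaguerrePolya
import Mathlib.Analysis.Complex.CauchyIntegral
import Mathlib.Analysis.Analytic.Uniqueness
import HarnessLib

/-!
# Constancy of the weighted orbit function gives the inversion law (line `Sketch`, stub S3a)

Stub `stub_orbitConst` of the line `Sketch` (§1, card `complex-circle-rotation-liouville`) for the crux
`MoebiusLimitExists` (item stmt-CriticalPhenomena-1344), over the objects of
`Theorems/EnergyNotSigmaSquaredMoebiusLimitExistsOrbitLiouvilleDefs.lean`.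

For a configuration `x ∈ OrbitGood n` let `F_x(ψ) = orbitFun Δ S n x ψ` be the weighted orbit function of
the family `S` along the elliptic Möbius flow `h_ψ = ellipticFlow ψ` ("rotation by `ψ` about the unit
circle"). Taking as HYPOTHESES the statements of stub S1 (Liouville for `2π`-periodic entire functions of
tempered growth) and stub S2 (the algebra of the flow: `2π`-periodicity, `h_0 = id`, `h_π = ι ∘ R₃` off
the origin with `ι = EuclideanGeometry.inversion 0 1` and `R₃ = flipThree`, positivity of the
denominator), we prove: if `F_x` is the restriction to `ℝ` of an entire function `F` of tempered growth,
then the inversion law holds at `x`,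
`S n (ι ∘ R₃ ∘ x) = ∏ᵢ ‖xᵢ‖^{2Δ} · S n x`.

Proof: `z ↦ F(z + 2π) − F(z)` is entire and vanishes on `ℝ` (periodicity of the weight and of the flow,
S2), hence vanishes identically (identity theorem, `Literature.Analysis.Complex.eq_zero_of_forall_ofReal_eq_zero`);
so `F` is `2π`-periodic on `ℂ`, hence constant (S1); in particular `F_x(π) = F_x(0)`, and evaluating both
sides with S2 (`D(y, 0) = 2`, `h_0 = id`; `D(y, π) = 2‖y‖²`, `h_π = ι ∘ R₃`) gives the law.

References: Möbius covariance of correlators and the unit inversion, Di Francesco–Mathieu–Sénéchal,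
*Conformal Field Theory* (1997), §4.3.1 (eq. (4.62)); identity theorem + Liouville (folklore).
-/

noncomputable section

open Set Function Filter EuclideanGeometry
open scoped Topology
open Literature.Probability.LatticeModels

namespace Summit.CriticalPhenomena.Ising3DConformalLimit.MoebiusLimitExistsOrbitLiouville

/-- The weighted orbit function is `2π`-periodic in the real angle as soon as the denominator `D` and
the flow `h_ψ` are (first clause of stub S2). [folklore] -/
theorem orbitFun_add_two_pi
    (hper : ∀ (y : EuclideanSpace ℝ (Fin 3)) (ψ : ℝ), flowDen y (ψ + 2 * Real.pi) = flowDen y ψ ∧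
      ellipticFlow (ψ + 2 * Real.pi) y = ellipticFlow ψ y)
    (Δ : ℝ) (S : CorrFamily 3) (n : ℕ) (x : Fin n → EuclideanSpace ℝ (Fin 3)) (ψ : ℝ) :
    orbitFun Δ S n x (ψ + 2 * Real.pi) = orbitFun Δ S n x ψ := by
  have h1 : ∀ (y : EuclideanSpace ℝ (Fin 3)) (ψ : ℝ), flowDen y (ψ + 2 * Real.pi) = flowDen y ψ :=
    fun y ψ => (hper y ψ).1
  have h2 : ∀ (y : EuclideanSpace ℝ (Fin 3)) (ψ : ℝ),
      ellipticFlow (ψ + 2 * Real.pi) y = ellipticFlow ψ y := fun y ψ => (hper y ψ).2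
  simp only [orbitFun, orbitWeight, h1, h2]

/-- At angle `0` the weighted orbit function is `S n x` (weight `1` since `D(y, 0) = 2`, and `h_0 = id`,
second clause of stub S2). [folklore] -/
theorem orbitFun_zero (h0 : ∀ y : EuclideanSpace ℝ (Fin 3), ellipticFlow 0 y = y)
    (Δ : ℝ) (S : CorrFamily 3) (n : ℕ) (x : Fin n → EuclideanSpace ℝ (Fin 3)) :
    orbitFun Δ S n x 0 = S n x := by
  simp only [orbitFun, orbitWeight, flowDen_at_zero, h0, (div_self two_ne_zero : (2 : ℝ) / 2 = 1),
    Real.one_rpow, Finset.prod_const_one, one_mul]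

/-- At angle `π` the weighted orbit function is `∏ᵢ ‖xᵢ‖^{-2Δ} · S n (ι R₃ x)` for a configuration off the
origin (weight `(2 / (2‖y‖²))^Δ = ‖y‖^{-2Δ}` per point since `D(y, π) = 2‖y‖²`, and `h_π = ι ∘ R₃`, third
clause of stub S2). [folklore] -/
theorem orbitFun_pi
    (hpi : ∀ y : EuclideanSpace ℝ (Fin 3), y ≠ 0 →
      ellipticFlow Real.pi y = EuclideanGeometry.inversion 0 1 (flipThree y))
    (Δ : ℝ) (S : CorrFamily 3) (n : ℕ) (x : Fin n → EuclideanSpace ℝ (Fin 3)) (hx : ∀ i, x i ≠ 0) :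
    orbitFun Δ S n x Real.pi =
      (∏ i, ‖x i‖ ^ (2 * Δ))⁻¹ * S n (fun i => EuclideanGeometry.inversion 0 1 (flipThree (x i))) := by
  have hw : ∀ i, (2 / flowDen (x i) Real.pi) ^ Δ = (‖x i‖ ^ (2 * Δ))⁻¹ := fun i => by
    rw [flowDen_at_pi, div_mul_cancel_left₀ two_ne_zero, Real.inv_rpow (sq_nonneg _), ← Real.rpow_two,
      ← Real.rpow_mul (norm_nonneg _)]
  have hflow : ∀ i, ellipticFlow Real.pi (x i) = EuclideanGeometry.inversion 0 1 (flipThree (x i)) :=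
    fun i => hpi _ (hx i)
  simp only [orbitFun, orbitWeight, hw, Finset.prod_inv_distrib, hflow]

/-- **Stub S3a — constancy of an entire tempered orbit function gives the inversion law on good
configurations** (from S1 and S2, taken as hypotheses): if `F_x` is the restriction of an entire
function `F` of tempered growth, then `z ↦ F(z + 2π) − F(z)` is entire and vanishes on `ℝ` (S2), hence
everywhere (identity theorem), so `F` is `2π`-periodic, hence constant (S1); evaluating `F_x(π) = F_x(0)`
with S2 (`D(xᵢ,0) = 2`, `h_0 = id`, `D(xᵢ,π) = 2‖xᵢ‖²`, `h_π = ι ∘ R₃`) gives the inversion law at `x` in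
the form `S n (ι R₃ x) = ∏ ‖xᵢ‖^{2Δ} · S n x`. [folklore] -/
theorem stub_orbitConst :
    (∀ F : ℂ → ℂ, Differentiable ℂ F → (∀ z, F (z + 2 * Real.pi) = F z) →
      (∃ (C : ℝ) (N : ℕ), ∀ z, ‖F z‖ ≤ C * (1 + |z.im|) ^ N) → ∀ z w, F z = F w) →
    ((∀ (y : EuclideanSpace ℝ (Fin 3)) (ψ : ℝ), flowDen y (ψ + 2 * Real.pi) = flowDen y ψ ∧
        ellipticFlow (ψ + 2 * Real.pi) y = ellipticFlow ψ y) ∧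
      (∀ y : EuclideanSpace ℝ (Fin 3), ellipticFlow 0 y = y) ∧
      (∀ y : EuclideanSpace ℝ (Fin 3), y ≠ 0 →
        ellipticFlow Real.pi y = EuclideanGeometry.inversion 0 1 (flipThree y)) ∧
      (∀ (y : EuclideanSpace ℝ (Fin 3)) (ψ : ℝ), (y 0 ≠ 0 ∨ y 1 ≠ 0) → 0 < flowDen y ψ)) →
    ∀ (Δ : ℝ) (S : CorrFamily 3) (n : ℕ) (x : Fin n → EuclideanSpace ℝ (Fin 3)), x ∈ OrbitGood n →
      (∃ F : ℂ → ℂ, Differentiable ℂ F ∧ (∃ (C : ℝ) (N : ℕ), ∀ z, ‖F z‖ ≤ C * (1 + |z.im|) ^ N) ∧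
        ∀ ψ : ℝ, F ψ = (orbitFun Δ S n x ψ : ℂ)) →
      S n (fun i => EuclideanGeometry.inversion 0 1 (flipThree (x i))) = (∏ i, ‖x i‖ ^ (2 * Δ)) * S n x := by
  intro hL hAlg Δ S n x hx hF
  obtain ⟨hper, h0, hpi, -⟩ := hAlg
  obtain ⟨F, hFd, hFg, hFo⟩ := hF
  -- every point of a good configuration is off the origin
  have hx0 : ∀ i, x i ≠ 0 := fun i hi => by
    rcases ((mem_orbitGood x).1 hx).2 i with h | h <;> exact h (by rw [hi]; rfl)
  -- `F` is `2π`-periodic on `ℂ`: the entire function `F(· + 2π) − F` vanishes on `ℝ`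
  have hperF : ∀ z, F (z + 2 * Real.pi) = F z := by
    have hGd : Differentiable ℂ (fun z => F (z + 2 * Real.pi) - F z) :=
      (hFd.comp (differentiable_id.add_const _)).sub hFd
    have hGr : ∀ t : ℝ, (fun z => F (z + 2 * Real.pi) - F z) t = 0 := fun t => by
      have ht : (t : ℂ) + 2 * Real.pi = ((t + 2 * Real.pi : ℝ) : ℂ) := by push_cast; ring
      simp only [ht, hFo, orbitFun_add_two_pi hper, sub_self]
    intro z
    exact sub_eq_zero.1 (Literature.Analysis.Complex.eq_zero_of_forall_ofReal_eq_zero hGd hGr z)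
  -- hence constant (S1): `F_x(π) = F_x(0)`, which is the inversion law at `x`
  have hc : F ((Real.pi : ℝ) : ℂ) = F ((0 : ℝ) : ℂ) := hL F hFd hperF hFg _ _
  rw [hFo, hFo, Complex.ofReal_inj, orbitFun_pi hpi Δ S n x hx0, orbitFun_zero h0,
    inv_mul_eq_iff_eq_mul₀ (Finset.prod_ne_zero_iff.2 fun i _ =>
      (Real.rpow_pos_of_pos (norm_pos_iff.2 (hx0 i)) _).ne')] at hc
  exact hc

end Summit.CriticalPhenomena.Ising3DConformalLimit.MoebiusLimitExistsOrbitLiouville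

end
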